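import Summits.CriticalPhenomena.PercolationContinuityZ3.Theorems.PercNearOneGluingNoHeavyLowerTailFrontierDecRowsTerminalEdgeInduction
import HarnessLib

/-!
# The UNMARKED-EDGE induction schema, I: under the invariant "every terminal has a spare"
# (`E₃ ≥ 0` from polarised Bernstein coefficients at edges from a terminal to an UNMARKED vertex — no terminal–terminal forms)

Support file (prover seat `prim-bnk-1`, gen 8; `--supports stmt-CriticalPhenomena-4575`).  No named facts, no sorries, no `native_decide`;
bookkeeping definitions `HasSpare`, `UnmarkedEdgeHyp`.  Sequel of `…FrontierDecRowsTerminalEdgeInduction` (same namespace `TerminalEdgeInduction`).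

WHY.  `TerminalEdgeInduction.sahiE3_nonneg_of_terminalEdgeHyp` needs the polarised forms at ALL terminal-incident edges, i.e. also at
terminal–terminal edges (four-point forms; 24 of them for rows 36/44, each with its own certificate).  They are unnecessary: a terminal–terminal
edge `(x i', x j)` can be turned into a (terminal, UNMARKED) edge by RE-MARKING `j` to another vertex of its weight-one component — provided
such a vertex exists.  This file runs the induction under that invariant; the companion `…FrontierDecRowsUnmarkedEdgeClone` removes the
invariant by adding pendant clones (one dimension up), so that in the end EVERY `k`-terminal pattern row on every finite weighted graph follows
from the (terminal, unmarked) forms alone — for four terminals: from cubic inequalities in ONE five-point (52-cell) law.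

* `HasSpare w x` — every terminal `x i` has a non-terminal vertex in its weight-one component (`oneCfg w`-component); preserved by raising weights
  (`HasSpare.mono`, `oneCfg_subset_update`) and by re-marking inside a component (`HasSpare.remark`).
* `UnmarkedEdgeHyp E₁ E₂ E₃` — for every `w`, injective `x`, terminal `i`, vertex `u` with `x j ≠ u` for all `j`, and `e = s(x i, u)`:
  `0 ≤ E₃` under `prodBernoulli w[e↦0]` and under `prodBernoulli w[e↦1]` (induction hypotheses, same marking) ⟹
  `0 ≤ polar₁ μ_{w[e↦0]} μ_{w[e↦1]} (E₁ x) (E₂ x) (E₃ x)` and `0 ≤ polar₁ μ_{w[e↦1]} μ_{w[e↦0]} (E₁ x) (E₂ x) (E₃ x)`.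
* **`sahiE3_nonneg_of_unmarkedEdgeHyp_of_hasSpare`**: for local families, `UnmarkedEdgeHyp E₁ E₂ E₃ → ∀ w x, Injective x → HasSpare w x →
  0 ≤ E₃(E₁ x, E₂ x, E₃ x)` under `prodBernoulli w`.  Proof: induction on the number of non-diagonal fractional edges as in the parent file; a
  fractional edge `zu` with `z` in the weight-one component of terminal `i` is made (terminal, unmarked) by at most two re-markings:
  `u` unmarked — re-mark `i ↦ z` if `z` is not a terminal; `u = x j` a terminal — if `z = x i'` is a terminal re-mark `j` to its spare and step
  at `i'` towards the old position of `j`; if `z` is unmarked and in the component of `j` re-mark `j ↦ z`; otherwise re-mark `i ↦ z` and `j` to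
  its spare; each re-marking keeps `E₃` (`sahiE3_remark`), injectivity and the invariant.  No touching fractional edge ⇒ `E₃ = 0`.
-/

noncomputable section

namespace Summit.CriticalPhenomena.PercolationContinuityZ3.Theorems

namespace TerminalEdgeInduction

open MeasureTheory Literature.Probability.Percolation Literature.Probability.LatticeModels
open EdgeInduction CovTransferCert E3GroupSepCert
open scoped Classical

variable {n k : ℕ}


/-! ### The invariant: every terminal has a SPARE (a non-terminal vertex in its weight-one component) -/

/-- `HasSpare w x`: the weight-one component of every terminal `x i` contains a vertex that is not a terminal. [this work] -/
def HasSpare (w : Sym2 (Fin n) → unitInterval) (x : Fin k → Fin n) : Prop :=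
  ∀ i, ∃ z, (openGraph (oneCfg w)).Reachable (x i) z ∧ ∀ j, x j ≠ z

/-- Raising weights keeps spares: if `oneCfg w ⊆ oneCfg w'` then `HasSpare w x → HasSpare w' x`. [this work] -/
theorem HasSpare.mono {w w' : Sym2 (Fin n) → unitInterval} {x : Fin k → Fin n} (h : HasSpare w x)
    (hw : oneCfg w ⊆ oneCfg w') : HasSpare w' x := by
  intro i
  obtain ⟨z, hz, hnz⟩ := h i
  exact ⟨z, hz.mono (SimpleGraph.fromEdgeSet_mono hw), hnz⟩

/-- Changing the weight of an edge that is not a weight-one edge never removes weight-one edges. [folklore] -/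
theorem oneCfg_subset_update {w : Sym2 (Fin n) → unitInterval} {e : Sym2 (Fin n)} (he : w e ≠ 1) (v : unitInterval) :
    oneCfg w ⊆ oneCfg (Function.update w e v) := by
  intro f hf
  have hfe : f ≠ e := by rintro rfl; exact he hf
  show Function.update w e v f = 1
  rw [Function.update_of_ne hfe]
  exact hf

/-- Re-marking a terminal to a non-terminal vertex of its weight-one component keeps the spares. [this work] -/
theorem HasSpare.remark {w : Sym2 (Fin n) → unitInterval} {x : Fin k → Fin n} (hx : Function.Injective x) (h : HasSpare w x)
    (i : Fin k) {z : Fin n} (hz : (openGraph (oneCfg w)).Reachable (x i) z) (hzx : ∀ j, x j ≠ z) :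
    HasSpare w (Function.update x i z) := by
  -- the old position `x i` is a non-terminal of the new marking, joined to `z` by weight-one edges
  have hold : ∀ l, Function.update x i z l ≠ x i := by
    intro l
    by_cases hl : l = i
    · subst hl; rw [Function.update_self]; exact (hzx l).symm
    · rw [Function.update_of_ne hl]; exact fun h' => hl (hx h')
  intro j
  by_cases hj : j = i
  · subst hj
    refine ⟨x j, ?_, hold⟩
    rw [Function.update_self]
    exact hz.symm
  · obtain ⟨zj, hr, hnt⟩ := h j
    by_cases hzz : zj = z
    · subst hzz
      refine ⟨x i, ?_, hold⟩
      rw [Function.update_of_ne hj]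
      exact hr.trans hz.symm
    · refine ⟨zj, ?_, ?_⟩
      · rw [Function.update_of_ne hj]; exact hr
      · intro l
        by_cases hl : l = i
        · subst hl; rw [Function.update_self]; exact fun h' => hzz h'.symm
        · rw [Function.update_of_ne hl]; exact hnt l

/-! ### The unmarked-edge hypotheses and the induction under the invariant -/

/-- **The UNMARKED terminal-edge hypotheses**: as `TerminalEdgeHyp`, but only for edges `s(x i, u)` from a terminal to an UNMARKED vertex
`u ∉ range x`, and with the induction hypotheses at the same marking: for every `w`, every injective `x`, every terminal `i` and every
`u` with `x j ≠ u` for all `j` — writing `e = s(x i, u)` — IF `0 ≤ E₃(E₁ x, E₂ x, E₃ x)` under `prodBernoulli w[e↦0]` and under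
`prodBernoulli w[e↦1]`, THEN `0 ≤ polar₁ μ_{w[e↦0]} μ_{w[e↦1]} (E₁ x) (E₂ x) (E₃ x)` and `0 ≤ polar₁ μ_{w[e↦1]} μ_{w[e↦0]} (E₁ x) (E₂ x) (E₃ x)`.
For `k` terminals these are cubic inequalities in ONE `(k+1)`-point pattern law (`…FrontierDecRowsTerminalEdgeStep`: five points, 52 cells,
when `k = 4`); NO terminal–terminal edge form is ever required. [this work] -/
def UnmarkedEdgeHyp (E₁ E₂ E₃ : (Fin k → Fin n) → Set (BondConfig (Fin n))) : Prop :=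
  ∀ (w : Sym2 (Fin n) → unitInterval) (x : Fin k → Fin n), Function.Injective x → ∀ (i : Fin k) (u : Fin n), (∀ j, x j ≠ u) →
    0 ≤ sahiE3 (prodBernoulli (Function.update w s(x i, u) 0)) (E₁ x) (E₂ x) (E₃ x) →
    0 ≤ sahiE3 (prodBernoulli (Function.update w s(x i, u) 1)) (E₁ x) (E₂ x) (E₃ x) →
    0 ≤ polar₁ (prodBernoulli (Function.update w s(x i, u) 0)) (prodBernoulli (Function.update w s(x i, u) 1))
        (E₁ x) (E₂ x) (E₃ x) ∧
    0 ≤ polar₁ (prodBernoulli (Function.update w s(x i, u) 1)) (prodBernoulli (Function.update w s(x i, u) 0))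
        (E₁ x) (E₂ x) (E₃ x)

variable {E₁ E₂ E₃ : (Fin k → Fin n) → Set (BondConfig (Fin n))}

/-- **The unmarked-edge schema under the invariant.**  For local families, `UnmarkedEdgeHyp` gives `0 ≤ E₃(E₁ x, E₂ x, E₃ x)` under
`prodBernoulli w` for every `w` and every injective marking `x` with `HasSpare w x`.
Proof: induction on the number of non-diagonal fractional edges; the invariant survives the weight updates (`HasSpare.mono`) and the
re-markings (`HasSpare.remark`), and it lets at most two re-markings turn any fractional edge at the weight-one component of a terminal into
an edge from a terminal to an unmarked vertex; if no fractional edge touches those components, `E₃ = 0`. [this work] -/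
theorem sahiE3_nonneg_of_unmarkedEdgeHyp_of_hasSpare (hE₁ : IsLocal E₁) (hE₂ : IsLocal E₂) (hE₃ : IsLocal E₃)
    (h : UnmarkedEdgeHyp E₁ E₂ E₃) (w : Sym2 (Fin n) → unitInterval) (x : Fin k → Fin n) (hx : Function.Injective x)
    (hs : HasSpare w x) : 0 ≤ sahiE3 (prodBernoulli w) (E₁ x) (E₂ x) (E₃ x) := by
  suffices H : ∀ (m : ℕ) (w : Sym2 (Fin n) → unitInterval), (frac w).card ≤ m →
      ∀ x : Fin k → Fin n, Function.Injective x → HasSpare w x → 0 ≤ sahiE3 (prodBernoulli w) (E₁ x) (E₂ x) (E₃ x) from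
    H _ w le_rfl x hx hs
  intro m
  induction m with
  | zero =>
      intro w hm x hx _
      have hB : ¬ Touch w x := by
        rintro ⟨z, u, -, hzu, h0, h1⟩
        have := Finset.card_pos.2 ⟨_, mem_frac hzu h0 h1⟩
        omega
      exact le_of_eq (sahiE3_eq_zero_of_not_touch hE₁ hE₂ hE₃ w x hB).symm
  | succ m ih =>
      intro w hm x hx hs
      -- the Bernstein step at a fractional edge from the terminal `j` to an UNMARKED vertex `u`
      have step : ∀ (x : Fin k → Fin n), Function.Injective x → HasSpare w x → ∀ (j : Fin k) (u : Fin n), (∀ l, x l ≠ u) →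
          (0 : ℝ) < w s(x j, u) → (w s(x j, u) : ℝ) < 1 → 0 ≤ sahiE3 (prodBernoulli w) (E₁ x) (E₂ x) (E₃ x) := by
        intro x hx hs j u hu h0 h1
        have he : s(x j, u) ∈ frac w := mem_frac (hu j) h0 h1
        have hne1 : w s(x j, u) ≠ 1 := by
          intro h1'; rw [h1'] at h1; simp at h1
        have hc0 : (frac (Function.update w s(x j, u) 0)).card ≤ m :=
          Nat.lt_succ_iff.1 (lt_of_lt_of_le (card_frac_update_lt w he 0 (Or.inl rfl)) hm)
        have hc1 : (frac (Function.update w s(x j, u) 1)).card ≤ m :=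
          Nat.lt_succ_iff.1 (lt_of_lt_of_le (card_frac_update_lt w he 1 (Or.inr rfl)) hm)
        have i0 := ih _ hc0 x hx (hs.mono (oneCfg_subset_update hne1 0))
        have i1 := ih _ hc1 x hx (hs.mono (oneCfg_subset_update hne1 1))
        obtain ⟨b1, b2⟩ := h w x hx j u hu i0 i1
        have hp0 : (0 : ℝ) ≤ w s(x j, u) := (w s(x j, u)).2.1
        have hp1 : (w s(x j, u) : ℝ) ≤ 1 := (w s(x j, u)).2.2
        have hq : (0 : ℝ) ≤ 1 - w s(x j, u) := sub_nonneg.2 hp1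
        rw [sahiE3_oneBond w s(x j, u) (E₁ x) (E₂ x) (E₃ x)]
        positivity
      -- one re-marking inside a weight-one component: same `E₃`, still injective, still with spares
      have remark : ∀ (x : Fin k → Fin n), Function.Injective x → HasSpare w x → ∀ (i : Fin k) (z : Fin n),
          (openGraph (oneCfg w)).Reachable (x i) z → (∀ j, x j ≠ z) →
          Function.Injective (Function.update x i z) ∧ HasSpare w (Function.update x i z) ∧
            sahiE3 (prodBernoulli w) (E₁ (Function.update x i z)) (E₂ (Function.update x i z)) (E₃ (Function.update x i z)) =
              sahiE3 (prodBernoulli w) (E₁ x) (E₂ x) (E₃ x) :=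
        fun x hx hs i z hz hzx =>
          ⟨injective_update_of_forall_ne hx hzx, hs.remark hx i hz hzx, sahiE3_remark hE₁ hE₂ hE₃ w x i z hz⟩
      by_cases hB : Touch w x
      · obtain ⟨z, u, ⟨i, hiz⟩, hzu, h0, h1⟩ := hB
        by_cases huS : ∃ j, x j = u
        · -- `u = x j` is a terminal
          obtain ⟨j, rfl⟩ := huS
          by_cases hzS : ∃ i', x i' = z
          · -- terminal–terminal edge `(x i', x j)`: move `j` to its spare, step at `i'` towards the old position of `j`
            obtain ⟨i', rfl⟩ := hzS
            have hij : i' ≠ j := fun h' => hzu (congrArg x h')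
            obtain ⟨zj, hzj, hzjS⟩ := hs j
            obtain ⟨hx', hs', hT⟩ := remark x hx hs j zj hzj hzjS
            rw [← hT]
            refine step _ hx' hs' i' (x j) ?_ ?_ ?_
            · intro l
              by_cases hl : l = j
              · subst hl; rw [Function.update_self]; exact (hzjS l).symm
              · rw [Function.update_of_ne hl]; exact fun h' => hl (hx h')
            · rw [Function.update_of_ne hij]; exact h0
            · rw [Function.update_of_ne hij]; exact h1
          · have hzS' : ∀ i', x i' ≠ z := fun i' h' => hzS ⟨i', h'⟩
            by_cases hjz : (openGraph (oneCfg w)).Reachable (x j) z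
            · -- `z` lies in the component of `j`: move `j` to `z`, step at `j` towards the old position of `j`
              obtain ⟨hx', hs', hT⟩ := remark x hx hs j z hjz hzS'
              rw [← hT]
              refine step _ hx' hs' j (x j) ?_ ?_ ?_
              · intro l
                by_cases hl : l = j
                · subst hl; rw [Function.update_self]; exact (hzS' l).symm
                · rw [Function.update_of_ne hl]; exact fun h' => hl (hx h')
              · rw [Function.update_self]; exact h0
              · rw [Function.update_self]; exact h1
            · -- `z` in the component of `i ≠ j`: move `i` to `z`, then `j` to its spare, step at `i` towards the old position of `j`
              have hij : i ≠ j := by rintro rfl; exact hjz hiz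
              obtain ⟨hx', hs', hT⟩ := remark x hx hs i z hiz hzS'
              obtain ⟨zj, hzj, hzjS⟩ := hs' j
              rw [Function.update_of_ne (Ne.symm hij)] at hzj
              obtain ⟨hx'', hs'', hT'⟩ := remark _ hx' hs' j zj (by rw [Function.update_of_ne (Ne.symm hij)]; exact hzj) hzjS
              rw [← hT, ← hT']
              refine step _ hx'' hs'' i (x j) ?_ ?_ ?_
              · intro l
                by_cases hl : l = j
                · subst hl
                  rw [Function.update_self]
                  have := hzjS l
                  rw [Function.update_of_ne (Ne.symm hij)] at this
                  exact this.symm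
                · rw [Function.update_of_ne hl]
                  by_cases hli : l = i
                  · subst hli; rw [Function.update_self]; exact fun h' => hzS' j h'.symm
                  · rw [Function.update_of_ne hli]; exact fun h' => hl (hx h')
              · rw [Function.update_of_ne hij, Function.update_self]; exact h0
              · rw [Function.update_of_ne hij, Function.update_self]; exact h1
        · -- `u` is unmarked
          have huS' : ∀ j, x j ≠ u := fun j h' => huS ⟨j, h'⟩
          by_cases hzS : ∃ i', x i' = z
          · obtain ⟨i', rfl⟩ := hzS
            exact step x hx hs i' u huS' h0 h1
          · have hzS' : ∀ i', x i' ≠ z := fun i' h' => hzS ⟨i', h'⟩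
            obtain ⟨hx', hs', hT⟩ := remark x hx hs i z hiz hzS'
            rw [← hT]
            refine step _ hx' hs' i u ?_ ?_ ?_
            · intro l
              by_cases hl : l = i
              · subst hl; rw [Function.update_self]; exact hzu
              · rw [Function.update_of_ne hl]; exact huS' l
            · rw [Function.update_self]; exact h0
            · rw [Function.update_self]; exact h1
      · exact le_of_eq (sahiE3_eq_zero_of_not_touch hE₁ hE₂ hE₃ w x hB).symm

end TerminalEdgeInduction

end Summit.CriticalPhenomena.PercolationContinuityZ3.Theorems
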